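import Literature.NumberTheory.ComplexMultiplication.CMTypeRankCommonConstituent
import Mathlib.RepresentationTheory.Irreducible
import HarnessLib

/-!
# The evaluation criterion for the rank of a family of CM types (the non-abelian form of Kubota's character count)

Companion of `NumberTheory/ComplexMultiplication/CMTypeRankFamilies` (setting: a group `G` acting slot by slot on
`⊔_i E_i` = Deligne's `Hom(∏_i K_i, ℂ)`, the family type `Σ = sigmaType Φ` of types `Φ_i ⊆ E_i`, the antisymmetric spans
`U(Φ_i) = antiSpan G (Φ_i)` spanned by the `±1`-vectors `u_g(Φ_i) = antiVec (Φ_i) g` of the translates, `U(Σ) ⊆ ⊕_i U(Φ_i)`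
always, `rank = dim U + 1`; rank ADDITIVITY `U(Σ) = ⊕_i U(Φ_i)` — on Hodge groups `Hg(∏_i A_i) = ∏_i Hg(A_i)` — is recorded
in the tree as `∀ i, ext_i U(Φ_i) ≤ U(Σ)`, see `CMTypeRankTypeConjugation` §0), of `CMTypeRankCharacters` (Kubota's Lemma 2:
for an ABELIAN group the rank is a count of odd characters not vanishing on the type; that file records "NOT here:
non-abelian Galois CM fields") and of `CMTypeRankCommonConstituent` (the pairwise "no common constituent" criterion).

For ONE type and `K` Galois, the representation-theoretic form of the rank is printed by L. Mai, *Lower bounds for the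
ranks of CM types*, J. Number Theory 32 (1989), §2, proof of Prop. 1 (held text `paper:doi-10-1016-0022-314x-89-90025-5`
p. 194): "We have `rank(K, S) = rank(reg(τ)) = Σ_π d_π rank(π(τ))`" (`τ = Σ_{s∈S} s ∈ ℤ[G]`, `π` over the irreducible
representations of `G = Gal(K/ℚ)`), of which Kubota's Lemma 2 is the abelian case.  Here the same mechanism is run for a
FAMILY of types on arbitrary `G`-sets (non-Galois fields, several fields), giving an exact criterion for additivity:

> **Theorem** (`forall_map_slotExt_le_iff_forall_irreducible`).  `U(Σ) = ⊕_i U(Φ_i)` **iff** for every irreducible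
> finite-dimensional `ℚ`-linear representation `(π, V)` of `G` the EVALUATION SUBSPACES
> `Ev_i(V) = {T(u_1(Φ_i)) : T : ℚ^{E_i} → V linear and G-equivariant}` (`i ∈ I`) are linearly independent in `V` — i.e.
> whenever equivariant `T_i : ℚ^{E_i} → V` satisfy `Σ_i T_i(u_1(Φ_i)) = 0`, every `T_i(u_1(Φ_i))` vanishes.

(`Ev_i(V)` is the column space of Mai's matrix `π(τ_i)` restricted to the `H_i`-invariants when `E_i = G/H_i`; for
commutative `G` and an odd character it is the line "`Σ_{s∈Φ_i} χ(s) ≠ 0`" of Kubota.)  The direction ⟹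
(`eval_eq_zero_of_forall_map_slotExt_le`) holds for EVERY representation, irreducible or not: the map
`f ↦ Σ_i T_i(f|_{E_i})` kills every `u_g(Σ)` (equivariance), hence `U(Σ) ∋ ext_i u_1(Φ_i)`, on which it is `T_i(u_1(Φ_i))`.
The direction ⟸ (`forall_map_slotExt_le_of_forall_irreducible`) uses no Maschke theorem and does not assume `G` finite:
the permutation module `ℚ^{⊔ E_i}` carries the `G`-invariant positive definite dot product, so every `G`-stable subspace
has a `G`-stable orthogonal complement; if `U(Σ) ≠ ⊕_i U(Φ_i)` then `(⊕_i U(Φ_i)) ∩ U(Σ)^⊥` contains a MINIMAL non-zero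
stable `P` (an irreducible representation), the orthogonal projection `p` onto `P` is equivariant and kills `U(Σ) ∋
u_1(Σ) = Σ_i ext_i u_1(Φ_i)`, so `Σ_i (p ∘ ext_i)(u_1(Φ_i)) = 0`; independence in `P` forces `p ∘ ext_i = 0` on every
`U(Φ_i)`, hence `p = 0` on `⊕_i U(Φ_i) ⊇ P`, contradicting `p|_P = id`.

CONSEQUENCES (same file): `linearIndependent_eval_of_forall_map_slotExt_le` — in an additive family, non-zero evaluation
vectors taken from distinct slots in ANY representation are linearly independent, so at most `dim V` slots can "touch" a
given `V` (`card_le_finrank_of_forall_map_slotExt_le`): the structural reason behind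
`SimpleCMSurfaceProducts.card_normalClosure_class_le_two` (`D₄`, `dim V = 2`) and the degenerate `D₄` surface triple.
Conventions: `G` acts on `ℚ^X` by `(g·f)(x) = f(g⁻¹x)`; "`T` equivariant for `π`" means `T(g·f) = π(g)(T f)`; irreducible =
Mathlib's `Representation.IsIrreducible`.  Theorems only: no definition, no named fact, no `sorry`.

## References

* [Mai1989] L. Mai, *Lower bounds for the ranks of CM types*, J. Number Theory 32 (1989) 192–202, §2 Prop. 1 (proof).
* [Kubota1965] T. Kubota, *On the field extension by complex multiplication*, Trans. AMS 118 (1965), Lemma 2.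
* [Gordon1999HodgeAVSurvey] B. B. Gordon, *A survey of the Hodge conjecture for abelian varieties*, §3, 9.4.1, 9.4.4.
* [Deligne1982HodgeCycles] P. Deligne, *Hodge cycles on abelian varieties*, LNM 900 (1982), I Ex. 3.7.
-/

set_option autoImplicit false

noncomputable section

open scoped BigOperators

universe u v w

namespace Literature.NumberTheory.ComplexMultiplication

variable {G : Type w} [Group G] {I : Type u} {E : I → Type v} [∀ i, MulAction G (E i)]

/-! ### §0 Tools: the invariant dot product, stable subspaces, restrictions -/

section Tools

variable {X : Type*} [MulAction G X]

/-- `u_g(Ψ) = g⁻¹ · u_1(Ψ)`: the `±1`-vector of the translate by `g` is `x ↦ u_1(gx)`. [cite: Dodson1987, §1.1 (p. 50)] -/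
theorem antiVec_eq_antiVec_one_comp_smul (Ψ : Set X) (g : G) :
    antiVec Ψ g = fun x => antiVec Ψ (1 : G) (g⁻¹⁻¹ • x) := by
  funext x
  simp only [antiVec, inv_inv, ← translateInd_mul, one_mul]

variable [Fintype X]

/-- The dot product on `ℚ^X` is invariant under permutations of `X` by `G`. [folklore] -/
private theorem dotProduct_comp_smul (f f' : X → ℚ) (g : G) :
    (fun x => f (g • x)) ⬝ᵥ (fun x => f' (g • x)) = f ⬝ᵥ f' :=
  Fintype.sum_equiv (MulAction.toPerm g) _ _ fun _ => rfl

/-- The orthogonal complement of a `G`-stable subspace of `ℚ^X` is `G`-stable. [folklore] -/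
private theorem comp_smul_mem_orthogonal {W : Submodule ℚ (X → ℚ)} (hW : ∀ g : G, ∀ f ∈ W, (fun x => f (g • x)) ∈ W)
    {m : X → ℚ} (hm : m ∈ LinearMap.BilinForm.orthogonal (dotProductBilin ℚ ℚ) W) (g : G) :
    (fun x => m (g • x)) ∈ LinearMap.BilinForm.orthogonal (dotProductBilin ℚ ℚ) W := by
  rw [LinearMap.BilinForm.mem_orthogonal_iff] at hm ⊢
  intro n hn
  have h1 := hm (fun x => n (g⁻¹ • x)) (hW g⁻¹ n hn)
  change _ ⬝ᵥ _ = 0 at h1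
  change n ⬝ᵥ _ = 0
  rw [← dotProduct_comp_smul (fun x => n (g⁻¹ • x)) m g] at h1
  simpa only [inv_smul_smul] using h1

/-- The dot product on `ℚ^X` is reflexive. [folklore] -/
private theorem isRefl_dotProductBilin : (dotProductBilin ℚ ℚ : LinearMap.BilinForm ℚ (X → ℚ)).IsRefl := by
  intro x y h
  change x ⬝ᵥ y = 0 at h
  change y ⬝ᵥ x = 0
  rwa [dotProduct_comm]

/-- The dot product restricted to any subspace of `ℚ^X` is non-degenerate (it is positive definite). [folklore] -/
private theorem restrict_dotProductBilin_nondegenerate (W : Submodule ℚ (X → ℚ)) :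
    (LinearMap.BilinForm.restrict (dotProductBilin ℚ ℚ : LinearMap.BilinForm ℚ (X → ℚ)) W).Nondegenerate := by
  refine ⟨fun m hm => ?_, fun m hm => ?_⟩
  all_goals
    have h := hm m
    rw [LinearMap.BilinForm.restrict_apply] at h
    change (m : X → ℚ) ⬝ᵥ (m : X → ℚ) = 0 at h
    exact Subtype.ext (dotProduct_self_eq_zero.1 h)

/-- Every subspace of `ℚ^X` is complemented by its orthogonal complement for the dot product. [folklore] -/
private theorem isCompl_orthogonal (W : Submodule ℚ (X → ℚ)) :
    IsCompl W (LinearMap.BilinForm.orthogonal (dotProductBilin ℚ ℚ) W) :=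
  LinearMap.BilinForm.isCompl_orthogonal_of_restrict_nondegenerate isRefl_dotProductBilin
    (restrict_dotProductBilin_nondegenerate W)

/-- A non-zero `G`-stable subspace of `ℚ^X` contains a MINIMAL non-zero `G`-stable subspace. [folklore] -/
private theorem exists_minimal_stable {C : Submodule ℚ (X → ℚ)} (hC : C ≠ ⊥)
    (hCst : ∀ g : G, ∀ f ∈ C, (fun x => f (g • x)) ∈ C) :
    ∃ P : Submodule ℚ (X → ℚ), P ≤ C ∧ P ≠ ⊥ ∧ (∀ g : G, ∀ f ∈ P, (fun x => f (g • x)) ∈ P) ∧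
      ∀ P' : Submodule ℚ (X → ℚ), P' ≤ P → P' ≠ ⊥ → (∀ g : G, ∀ f ∈ P', (fun x => f (g • x)) ∈ P') → P' = P := by
  classical
  have hex : ∃ n, ∃ P : Submodule ℚ (X → ℚ), P ≤ C ∧ P ≠ ⊥ ∧
      (∀ g : G, ∀ f ∈ P, (fun x => f (g • x)) ∈ P) ∧ Module.finrank ℚ P = n :=
    ⟨_, C, le_rfl, hC, hCst, rfl⟩
  obtain ⟨P, hPC, hP0, hPst, hPn⟩ := Nat.find_spec hex
  refine ⟨P, hPC, hP0, hPst, fun P' hP'P hP'0 hP'st => ?_⟩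
  have hmin := Nat.find_min' hex ⟨P', hP'P.trans hPC, hP'0, hP'st, rfl⟩
  exact Submodule.eq_of_le_of_finrank_eq hP'P (le_antisymm (Submodule.finrank_mono hP'P) (hPn ▸ hmin))

end Tools

/-! ### §1 Additivity forces independence of the evaluation subspaces — in every representation -/

section Necessity

variable [DecidableEq I]

/-- Restricting the extension by zero from the slot `i` back to the slot `j`: the given weight for `j = i`, zero otherwise.
[cite: Gordon1999HodgeAVSurvey, §3 Theorem (proof)] -/
theorem funLeft_mk_slotExt (i j : I) (a : E i → ℚ) :
    LinearMap.funLeft ℚ ℚ (Sigma.mk j) (slotExt i a) = if h : j = i then h ▸ a else 0 := by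
  funext s
  by_cases hji : j = i
  · subst hji
    simp only [LinearMap.funLeft_apply, slotExt_apply_same, dite_true]
  · simp only [LinearMap.funLeft_apply, slotExt_apply_of_ne hji, hji, dite_false, Pi.zero_apply]

variable [Fintype I]

/-- `Σ_j T_j((ext_i a)|_{E_j}) = T_i(a)`. [folklore] -/
private theorem sum_apply_funLeft_mk_slotExt {V : Type*} [AddCommGroup V] [Module ℚ V] (T : ∀ i, (E i → ℚ) →ₗ[ℚ] V)
    (i : I) (a : E i → ℚ) : ∑ j, T j (LinearMap.funLeft ℚ ℚ (Sigma.mk j) (slotExt i a)) = T i a := by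
  rw [Finset.sum_eq_single i (fun j _ hji => by rw [funLeft_mk_slotExt, dif_neg hji, map_zero])
    (fun hi => (hi (Finset.mem_univ i)).elim), funLeft_mk_slotExt, dif_pos rfl]

/-- **Additivity ⟹ independence of the evaluation subspaces, in EVERY representation.**  If `ext_i U(Φ_i) ≤ U(Σ)` for
all `i` and `T_i : ℚ^{E_i} → V` are `G`-equivariant linear maps to a representation `(π, V)` with
`Σ_i T_i(u_1(Φ_i)) = 0`, then every `T_i(u_1(Φ_i)) = 0` (the map `f ↦ Σ_i T_i(f|_{E_i})` kills each `u_g(Σ) = g⁻¹·u_1(Σ)`,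
hence `U(Σ) ∋ ext_i u_1(Φ_i)`).  Single type, `K` Galois: Mai's `rank = Σ_π d_π rank π(τ)`. [cite: Mai1989, §2 Prop. 1 (proof)] -/
theorem eval_eq_zero_of_forall_map_slotExt_le (Φ : ∀ i, Set (E i))
    (hadd : ∀ i, (antiSpan G (Φ i)).map (slotExt i) ≤ antiSpan G (sigmaType Φ))
    {V : Type*} [AddCommGroup V] [Module ℚ V] (π : Representation ℚ G V) (T : ∀ i, (E i → ℚ) →ₗ[ℚ] V)
    (hT : ∀ i (g : G) (f : E i → ℚ), T i (fun x => f (g⁻¹ • x)) = π g (T i f))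
    (hsum : ∑ i, T i (antiVec (Φ i) (1 : G)) = 0) (i : I) : T i (antiVec (Φ i) (1 : G)) = 0 := by
  let Ttot : ((Σ k, E k) → ℚ) →ₗ[ℚ] V := ∑ j, T j ∘ₗ LinearMap.funLeft ℚ ℚ (Sigma.mk j)
  have hTtot : ∀ f, Ttot f = ∑ j, T j (LinearMap.funLeft ℚ ℚ (Sigma.mk j) f) := fun f => by
    simp only [Ttot, LinearMap.sum_apply, LinearMap.comp_apply]
  have hker : antiSpan G (sigmaType Φ) ≤ LinearMap.ker Ttot := by
    refine Submodule.span_le.2 ?_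
    rintro _ ⟨g, rfl⟩
    rw [SetLike.mem_coe, LinearMap.mem_ker, hTtot]
    have hj : ∀ j, T j (LinearMap.funLeft ℚ ℚ (Sigma.mk j) (antiVec (sigmaType Φ) g)) =
        π g⁻¹ (T j (antiVec (Φ j) (1 : G))) := fun j => by
      rw [funLeft_mk_antiVec_sigmaType, antiVec_eq_antiVec_one_comp_smul (Φ j) g, hT j g⁻¹]
    simp only [hj, ← map_sum]
    rw [hsum, map_zero]
  have hmem : slotExt i (antiVec (Φ i) (1 : G)) ∈ LinearMap.ker Ttot :=
    hker (hadd i ⟨antiVec (Φ i) (1 : G), Submodule.subset_span ⟨1, rfl⟩, rfl⟩)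
  rw [LinearMap.mem_ker, hTtot, sum_apply_funLeft_mk_slotExt] at hmem
  exact hmem

/-- **Capacity.**  In an additive family, NON-ZERO evaluation vectors `T_i(u_1(Φ_i))` taken from the slots of a finite
set `S` in any representation `(π, V)` are linearly independent. [cite: Mai1989, §2 Prop. 1 (proof)] -/
theorem linearIndependent_eval_of_forall_map_slotExt_le (Φ : ∀ i, Set (E i))
    (hadd : ∀ i, (antiSpan G (Φ i)).map (slotExt i) ≤ antiSpan G (sigmaType Φ))
    {V : Type*} [AddCommGroup V] [Module ℚ V] (π : Representation ℚ G V) (T : ∀ i, (E i → ℚ) →ₗ[ℚ] V)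
    (hT : ∀ i (g : G) (f : E i → ℚ), T i (fun x => f (g⁻¹ • x)) = π g (T i f))
    (S : Finset I) (hS : ∀ i ∈ S, T i (antiVec (Φ i) (1 : G)) ≠ 0) :
    LinearIndependent ℚ fun i : S => T i (antiVec (Φ i) (1 : G)) := by
  classical
  rw [Fintype.linearIndependent_iff]
  intro c hc i
  let c' : I → ℚ := fun j => if h : j ∈ S then c ⟨j, h⟩ else 0
  let T' : ∀ j, (E j → ℚ) →ₗ[ℚ] V := fun j => c' j • T j
  have hT' : ∀ j (g : G) (f : E j → ℚ), T' j (fun x => f (g⁻¹ • x)) = π g (T' j f) := fun j g f => by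
    simp only [T', LinearMap.smul_apply, hT j g f, map_smul]
  have hsum : ∑ j, T' j (antiVec (Φ j) (1 : G)) = 0 := by
    rw [← Finset.sum_subset (Finset.subset_univ S) (fun j _ hj => by
      simp only [T', c', dif_neg hj, zero_smul, LinearMap.zero_apply]), ← Finset.sum_coe_sort]
    refine Eq.trans (Finset.sum_congr rfl fun j _ => ?_) hc
    simp only [T', c', LinearMap.smul_apply, dif_pos j.2, Subtype.coe_eta]
  have h := eval_eq_zero_of_forall_map_slotExt_le Φ hadd π T' hT' hsum i
  simp only [T', c', LinearMap.smul_apply, dif_pos i.2, smul_eq_zero] at h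
  exact h.resolve_right (hS i i.2)

/-- **At most `dim V` slots touch `V`.**  In an additive family, if the slots of `S` all have a non-zero evaluation vector
in the finite-dimensional representation `(π, V)`, then `|S| ≤ dim V` — e.g. at most two pairwise non-isogenous simple CM
abelian surfaces per dihedral Galois closure (`dim V = 2`). [cite: Mai1989, §2 Prop. 1 (proof)] -/
theorem card_le_finrank_of_forall_map_slotExt_le (Φ : ∀ i, Set (E i))
    (hadd : ∀ i, (antiSpan G (Φ i)).map (slotExt i) ≤ antiSpan G (sigmaType Φ))
    {V : Type*} [AddCommGroup V] [Module ℚ V] [FiniteDimensional ℚ V] (π : Representation ℚ G V)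
    (T : ∀ i, (E i → ℚ) →ₗ[ℚ] V) (hT : ∀ i (g : G) (f : E i → ℚ), T i (fun x => f (g⁻¹ • x)) = π g (T i f))
    (S : Finset I) (hS : ∀ i ∈ S, T i (antiVec (Φ i) (1 : G)) ≠ 0) : S.card ≤ Module.finrank ℚ V := by
  have h := (linearIndependent_eval_of_forall_map_slotExt_le Φ hadd π T hT S hS).fintype_card_le_finrank
  rwa [Fintype.card_coe] at h

end Necessity

/-! ### §2 Independence in every irreducible representation forces additivity -/

section Sufficiency

/-- A weight on `⊔_i E_i` is assembled from its slot restrictions. [folklore] -/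
private theorem sigmaLift_funLeft_mk (f : (Σ i, E i) → ℚ) :
    sigmaLift (fun j => LinearMap.funLeft ℚ ℚ (Sigma.mk j) f) = f := by
  funext x
  obtain ⟨j, s⟩ := x
  rfl

/-- `U(Σ) ≤ {f | every slot restriction f|_{E_i} ∈ U(Φ_i)}` (= `⊕_i U(Φ_i)`). [cite: Gordon1999HodgeAVSurvey, §3 Theorem (proof)] -/
theorem antiSpan_sigmaType_le_iInf_comap (Φ : ∀ i, Set (E i)) :
    antiSpan G (sigmaType Φ) ≤ ⨅ j, (antiSpan G (Φ j)).comap (LinearMap.funLeft ℚ ℚ (Sigma.mk j)) := by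
  refine Submodule.span_le.2 ?_
  rintro _ ⟨g, rfl⟩
  rw [SetLike.mem_coe, Submodule.mem_iInf]
  intro j
  rw [Submodule.mem_comap, funLeft_mk_antiVec_sigmaType]
  exact Submodule.subset_span ⟨g, rfl⟩

/-- `ext_i U(Φ_i) ≤ {f | every slot restriction f|_{E_j} ∈ U(Φ_j)}`. [cite: Gordon1999HodgeAVSurvey, §3 Theorem (proof)] -/
theorem map_slotExt_le_iInf_comap [DecidableEq I] (Φ : ∀ i, Set (E i)) (i : I) :
    (antiSpan G (Φ i)).map (slotExt i) ≤ ⨅ j, (antiSpan G (Φ j)).comap (LinearMap.funLeft ℚ ℚ (Sigma.mk j)) := by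
  rintro _ ⟨a, ha, rfl⟩
  rw [Submodule.mem_iInf]
  intro j
  rw [Submodule.mem_comap, funLeft_mk_slotExt]
  by_cases hji : j = i
  · subst hji
    rw [dif_pos rfl]
    exact ha
  · rw [dif_neg hji]
    exact Submodule.zero_mem _

variable [DecidableEq I] [Fintype I] [∀ i, Fintype (E i)]

/-- **Independence of the evaluation subspaces in every IRREDUCIBLE finite-dimensional representation ⟹ additivity
`U(Σ) = ⊕_i U(Φ_i)`.**  (Via the invariant dot product: a minimal stable `P` inside `(⊕_i U(Φ_i)) ∩ U(Σ)^⊥` and the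
equivariant projection onto `P`; no Maschke theorem, `G` not assumed finite.) [cite: Mai1989, §2 Prop. 1 (proof)] -/
theorem forall_map_slotExt_le_of_forall_irreducible (Φ : ∀ i, Set (E i))
    (hind : ∀ (V : Type (max u v)) [AddCommGroup V] [Module ℚ V] [FiniteDimensional ℚ V]
      (π : Representation ℚ G V), π.IsIrreducible → ∀ T : ∀ i, (E i → ℚ) →ₗ[ℚ] V,
      (∀ i (g : G) (f : E i → ℚ), T i (fun x => f (g⁻¹ • x)) = π g (T i f)) →
      ∑ i, T i (antiVec (Φ i) (1 : G)) = 0 → ∀ i, T i (antiVec (Φ i) (1 : G)) = 0) :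
    ∀ i, (antiSpan G (Φ i)).map (slotExt i) ≤ antiSpan G (sigmaType Φ) := by
  classical
  -- notation
  set M : Submodule ℚ ((Σ k, E k) → ℚ) := antiSpan G (sigmaType Φ) with hM
  set Uf : Submodule ℚ ((Σ k, E k) → ℚ) := ⨅ j, (antiSpan G (Φ j)).comap (LinearMap.funLeft ℚ ℚ (Sigma.mk j))
    with hUf
  let B : LinearMap.BilinForm ℚ ((Σ k, E k) → ℚ) := dotProductBilin ℚ ℚ
  -- it suffices to prove `Uf ≤ M`
  suffices key : Uf ≤ M from fun i => (map_slotExt_le_iInf_comap Φ i).trans key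
  by_contra hnot
  obtain ⟨f, hfU, hfM⟩ := SetLike.not_le_iff_exists.1 hnot
  -- stability of `M`, `Uf`, `Mᗮ`
  have hMst : ∀ g : G, ∀ m ∈ M, (fun x => m (g • x)) ∈ M := fun g m hm => comp_smul_mem_antiSpan hm g
  have hUfst : ∀ g : G, ∀ m ∈ Uf, (fun x => m (g • x)) ∈ Uf := fun g m hm => by
    rw [hUf, Submodule.mem_iInf] at hm ⊢
    intro j
    have hmj := hm j
    rw [Submodule.mem_comap] at hmj ⊢
    exact comp_smul_mem_antiSpan hmj g
  -- decompose `f = m + c` with `m ∈ M`, `c ∈ Mᗮ`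
  have hcM := isCompl_orthogonal M
  obtain ⟨m, hm, c, hc, hmc⟩ := Submodule.mem_sup.1 (hcM.sup_eq_top.symm ▸ Submodule.mem_top (x := f))
  have hcU : c ∈ Uf := by
    have : c = f - m := by rw [← hmc]; abel
    rw [this]
    exact Uf.sub_mem hfU (antiSpan_sigmaType_le_iInf_comap Φ hm)
  have hc0 : c ≠ 0 := by
    rintro rfl
    rw [add_zero] at hmc
    exact hfM (hmc ▸ hm)
  -- the stable subspace `C = Uf ∩ Mᗮ ≠ 0` and a minimal stable `P ≤ C`
  set C : Submodule ℚ ((Σ k, E k) → ℚ) := Uf ⊓ B.orthogonal M with hC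
  have hC0 : C ≠ ⊥ := fun h => hc0 ((Submodule.eq_bot_iff _).1 h c ⟨hcU, hc⟩)
  have hCst : ∀ g : G, ∀ m ∈ C, (fun x => m (g • x)) ∈ C := fun g m hm =>
    ⟨hUfst g m hm.1, comp_smul_mem_orthogonal hMst hm.2 g⟩
  obtain ⟨P, hPC, hP0, hPst, hPmin⟩ := exists_minimal_stable hC0 hCst
  -- the representation of `G` on `P`: `(g·f)(x) = f(g⁻¹x)`
  let L : G → ((Σ k, E k) → ℚ) →ₗ[ℚ] ((Σ k, E k) → ℚ) := fun g => LinearMap.funLeft ℚ ℚ fun x => g⁻¹ • x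
  have hL : ∀ g (f : (Σ k, E k) → ℚ), L g f = fun x => f (g⁻¹ • x) := fun g f => rfl
  have hLP : ∀ g, ∀ p ∈ P, L g p ∈ P := fun g p hp => hPst g⁻¹ p hp
  let πP : Representation ℚ G P :=
    { toFun := fun g => (L g).restrict (hLP g)
      map_one' := by
        ext p x
        simp only [LinearMap.coe_restrict_apply, hL, inv_one, one_smul, Module.End.one_apply]
      map_mul' := fun g h => by
        ext p x
        simp only [LinearMap.coe_restrict_apply, hL, mul_inv_rev, mul_smul, Module.End.mul_apply] }
  have hπP : ∀ g (p : P), (πP g p : (Σ k, E k) → ℚ) = fun x => (p : (Σ k, E k) → ℚ) (g⁻¹ • x) := fun g p => rfl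
  -- `P` is irreducible
  have hPirr : πP.IsIrreducible := by
    haveI : Nontrivial (Subrepresentation πP) := by
      refine ⟨⟨⊥, ⊤, fun h => hP0 ?_⟩⟩
      have h' : (⊥ : Submodule ℚ P) = ⊤ := congrArg Subrepresentation.toSubmodule h
      rw [Submodule.eq_bot_iff]
      intro x hx
      have : (⟨x, hx⟩ : P) ∈ (⊥ : Submodule ℚ P) := h' ▸ Submodule.mem_top
      rw [Submodule.mem_bot] at this
      exact congrArg Subtype.val this
    refine ⟨fun W => ?_⟩
    let W' : Submodule ℚ ((Σ k, E k) → ℚ) := W.toSubmodule.map P.subtype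
    have hW'P : W' ≤ P := by
      rintro _ ⟨w, -, rfl⟩
      exact w.2
    have hW'st : ∀ g : G, ∀ m ∈ W', (fun x => m (g • x)) ∈ W' := by
      rintro g _ ⟨w, hw, rfl⟩
      refine ⟨πP g⁻¹ w, W.apply_mem_toSubmodule g⁻¹ hw, ?_⟩
      rw [Submodule.coe_subtype, hπP, inv_inv]
    by_cases hW'0 : W' = ⊥
    · left
      apply Subrepresentation.toSubmodule_injective
      change W.toSubmodule = ⊥
      rw [eq_bot_iff]
      intro w hw
      have : (w : (Σ k, E k) → ℚ) ∈ W' := ⟨w, hw, rfl⟩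
      rw [hW'0, Submodule.mem_bot] at this
      rw [Submodule.mem_bot]
      exact Subtype.ext this
    · right
      have hW'eq := hPmin W' hW'P hW'0 hW'st
      apply Subrepresentation.toSubmodule_injective
      change W.toSubmodule = ⊤
      rw [eq_top_iff]
      rintro ⟨p, hp⟩ -
      have : p ∈ W' := hW'eq ▸ hp
      obtain ⟨w, hw, hwp⟩ := this
      have : w = ⟨p, hp⟩ := Subtype.ext hwp
      exact this ▸ hw
  -- the equivariant projection onto `P`
  have hcP := isCompl_orthogonal P
  let proj : ((Σ k, E k) → ℚ) →ₗ[ℚ] P := P.projectionOnto (B.orthogonal P) hcP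
  have hPOst : ∀ g : G, ∀ q ∈ B.orthogonal P, (fun x => q (g • x)) ∈ B.orthogonal P := fun g q hq =>
    comp_smul_mem_orthogonal hPst hq g
  have hproj : ∀ g (f : (Σ k, E k) → ℚ), proj (fun x => f (g⁻¹ • x)) = πP g (proj f) := fun g f => by
    obtain ⟨p, hp, q, hq, rfl⟩ := Submodule.mem_sup.1 (hcP.sup_eq_top.symm ▸ Submodule.mem_top (x := f))
    have hsplit : (fun x => (p + q) (g⁻¹ • x)) = (fun x => p (g⁻¹ • x)) + fun x => q (g⁻¹ • x) := rfl
    rw [hsplit, map_add, map_add, Submodule.projectionOnto_apply_of_mem_left hcP (hPst g⁻¹ p hp),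
      Submodule.projectionOnto_apply_of_mem_right hcP (hPOst g⁻¹ q hq),
      Submodule.projectionOnto_apply_of_mem_left hcP hp, Submodule.projectionOnto_apply_of_mem_right hcP hq,
      add_zero, map_add, map_zero, add_zero]
    exact Subtype.ext (hπP g ⟨p, hp⟩).symm
  -- the equivariant maps `T_j = proj ∘ ext_j`
  let T : ∀ j, (E j → ℚ) →ₗ[ℚ] P := fun j => proj ∘ₗ slotExt j
  have hT : ∀ j (g : G) (a : E j → ℚ), T j (fun s => a (g⁻¹ • s)) = πP g (T j a) := fun j g a => by
    simp only [T, LinearMap.comp_apply, ← slotExt_comp_smul, hproj]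
  -- `M ≤ Pᗮ`, so `Σ_j T_j(u_1(Φ_j)) = proj(u_1(Σ)) = 0`
  have hMP : M ≤ B.orthogonal P := fun m hm => by
    rw [LinearMap.BilinForm.mem_orthogonal_iff]
    intro p hp
    have hp' : p ∈ B.orthogonal M := (hPC hp).2
    rw [LinearMap.BilinForm.mem_orthogonal_iff] at hp'
    exact isRefl_dotProductBilin _ _ (hp' m hm)
  have hsum : ∑ j, T j (antiVec (Φ j) (1 : G)) = 0 := by
    simp only [T, LinearMap.comp_apply, ← map_sum, ← sigmaLift_eq_sum_slotExt, ← antiVec_sigmaType_eq_sigmaLift]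
    exact Submodule.projectionOnto_apply_of_mem_right hcP (hMP (Submodule.subset_span ⟨1, rfl⟩))
  -- independence in the irreducible `P`: every `T_j(u_1(Φ_j))` vanishes, hence `proj ∘ ext_j = 0` on `U(Φ_j)`
  have hzero := hind P πP hPirr T hT hsum
  have hext : ∀ j, (antiSpan G (Φ j)).map (slotExt j) ≤ B.orthogonal P := fun j => by
    rw [Submodule.map_le_iff_le_comap, antiSpan]
    refine Submodule.span_le.2 ?_
    rintro _ ⟨g, rfl⟩
    rw [SetLike.mem_coe, Submodule.mem_comap, ← Submodule.projectionOnto_apply_eq_zero_iff hcP]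
    change T j (antiVec (Φ j) g) = 0
    rw [antiVec_eq_antiVec_one_comp_smul (Φ j) g, hT j g⁻¹, hzero j, map_zero]
  -- hence `Uf ≤ Pᗮ`, and `P ≤ C ≤ Uf ≤ Pᗮ` forces `P = 0`
  have hUfP : Uf ≤ B.orthogonal P := fun f' hf' => by
    rw [← sigmaLift_funLeft_mk f', sigmaLift_eq_sum_slotExt]
    refine Submodule.sum_mem _ fun j _ => hext j ⟨_, ?_, rfl⟩
    rw [hUf, Submodule.mem_iInf] at hf'
    exact hf' j
  exact hP0 (eq_bot_iff.2 fun p hp => (hcP.inf_eq_bot ▸ ⟨hp, hUfP (hPC hp).1⟩ : p ∈ (⊥ : Submodule ℚ _)))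

/-- **The evaluation criterion** (non-abelian Kubota): `U(Σ) = ⊕_i U(Φ_i)` — rank additivity `rank(Σ) − 1 =
Σ_i (rank(Φ_i) − 1)`, `Hg(∏ A_i) = ∏ Hg(A_i)` — **iff** in every irreducible finite-dimensional `ℚ`-representation `(π, V)`
of `G` the evaluation subspaces `{T(u_1(Φ_i)) : T : ℚ^{E_i} → V equivariant}` are linearly independent.
[cite: Mai1989, §2 Prop. 1 (proof)] [cite: Kubota1965, Lemma 2] -/
theorem forall_map_slotExt_le_iff_forall_irreducible (Φ : ∀ i, Set (E i)) :
    (∀ i, (antiSpan G (Φ i)).map (slotExt i) ≤ antiSpan G (sigmaType Φ)) ↔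
      ∀ (V : Type (max u v)) [AddCommGroup V] [Module ℚ V] [FiniteDimensional ℚ V]
        (π : Representation ℚ G V), π.IsIrreducible → ∀ T : ∀ i, (E i → ℚ) →ₗ[ℚ] V,
        (∀ i (g : G) (f : E i → ℚ), T i (fun x => f (g⁻¹ • x)) = π g (T i f)) →
        ∑ i, T i (antiVec (Φ i) (1 : G)) = 0 → ∀ i, T i (antiVec (Φ i) (1 : G)) = 0 :=
  ⟨fun hadd _ _ _ _ π _ T hT hsum => eval_eq_zero_of_forall_map_slotExt_le Φ hadd π T hT hsum,
    forall_map_slotExt_le_of_forall_irreducible Φ⟩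

end Sufficiency

end Literature.NumberTheory.ComplexMultiplication
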